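import Mathlib.Analysis.SpecialFunctions.Integrals.Basic
import Mathlib.MeasureTheory.Integral.IntervalIntegral.Basic
import HarnessLib

/-!
# Heat-weight integrals of the Fujita–Kato scheme

Elementary real-variable layer of the discharge programme for `Literature.Analysis.FluidPDE.fujita_kato_local` (plan:
`Literature/Analysis/FluidPDE/FujitaKatoLocal.lean`; Lemarié-Rieusset, *The Navier–Stokes
problem in the 21st century*, 2nd ed. 2023, §8.8, PDF pp. 209–210, and proof of Thm. 7.4,
PDF pp. 151–152). In the Fourier-side Duhamel term the heat factor `e^{-c(t-s)|ξ|²}` must absorb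
the derivative `|ξ|` of the nonlinearity against the time singularity `s^{-1/2}` produced by two
factors of the Fujita–Kato weight `s^{-1/4}`. All PROVED:

* `exp_neg_mul_rpow_le_one`: `e^{-x} x^a ≤ 1` (`x ≥ 0`, `0 ≤ a ≤ 1`);
* `exp_heat_mul_le`: the heat gain `e^{-c r² τ} r ≤ c^{-a} τ^{-a} r^{1-2a}`;
* `lintegral_Ioc_rpow`, `lintegral_Ioc_sub_rpow`: `∫⁻` of `s^p` and `(t-s)^p`, `p > -1`;
* `lintegral_rpow_mul_rpow_le`: the Beta-type bound
  `∫₀ᵗ (t-s)^{-a} s^{-1/2} ds ≤ (2 + 1/(1-a)) (t/2)^{1/2-a}` (`0 ≤ a < 1`, split at `t/2`);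
* `lintegral_heatWeight_le`:
  `∫₀ᵗ e^{-c r²(t-s)} r s^{-1/2} ds ≤ c^{-a} r^{1-2a} (2 + 1/(1-a)) (t/2)^{1/2-a}`, used with
  `a = 3/4, 1/2, 1/4` for the `𝓕Ḣ¹`-majorant, the `𝓕Ḣ^{1/2}` bound and the `L²` bound.

Everything is stated for set lower integrals `∫⁻ s in Ioo 0 t, ENNReal.ofReal …`, the form in
which `‖∫ F ds‖ₑ ≤ ∫⁻ ‖F‖ₑ ds` delivers the Duhamel integral.

## Mathlib search

Used: `integral_rpow`, `intervalIntegral.intervalIntegrable_rpow'`,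
`IntervalIntegrable.comp_sub_left`, `intervalIntegral.integral_comp_sub_left`,
`ofReal_integral_eq_lintegral_ofReal`, `Real.add_one_le_exp`, `Real.rpow_le_rpow_of_nonpos`.
Mathlib's Beta function (`Complex.betaIntegral`) is not needed: crude constants suffice.

## References

* P. G. Lemarié-Rieusset, *The Navier–Stokes problem in the 21st century*, 2nd ed., CRC Press
  2023, §8.8 (PDF pp. 209–210); proof of Thm. 7.4 (PDF pp. 151–152). [Lemarierieusset2023]
-/

noncomputable section

open MeasureTheory Set Real
open scoped ENNReal

namespace Literature.Analysis.FluidPDE.FujitaKato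

/-! ### `e^{-x} x^a ≤ 1` and the heat gain -/

/-- For `x ≥ 0` and `0 ≤ a ≤ 1`, `e^{-x} x^a ≤ 1` (`x^a ≤ max(1, x) ≤ e^x`). [folklore] -/
theorem exp_neg_mul_rpow_le_one {x a : ℝ} (hx : 0 ≤ x) (ha0 : 0 ≤ a) (ha1 : a ≤ 1) :
    Real.exp (-x) * x ^ a ≤ 1 := by
  have hexp : Real.exp (-x) ≤ 1 := by
    rw [Real.exp_le_one_iff]; linarith
  rcases le_total x 1 with h | h
  · exact mul_le_one₀ hexp (Real.rpow_nonneg hx _) (Real.rpow_le_one hx h ha0)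
  · have hxa : x ^ a ≤ x := by
      calc x ^ a ≤ x ^ (1 : ℝ) := Real.rpow_le_rpow_of_exponent_le h ha1
        _ = x := Real.rpow_one x
    have hex : x ≤ Real.exp x := by linarith [Real.add_one_le_exp x]
    calc Real.exp (-x) * x ^ a ≤ Real.exp (-x) * Real.exp x := by gcongr; exact hxa.trans hex
      _ = 1 := by rw [← Real.exp_add]; simp

/-- **Heat gain.** For `c, τ, r > 0` and `0 ≤ a ≤ 1`,
`e^{-c r² τ} r ≤ c^{-a} τ^{-a} r^{1-2a}`: the heat factor trades `2a` powers of the frequency for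
`a` powers of the elapsed time (Lemarié-Rieusset 2023, §8.8, PDF p. 209:
`e^{-ν(t-s)|ξ|²} ≤ C (ν(t-s))^{-3/4} |ξ|^{-3/2}`, here for general `a`). [cite: Lemarierieusset2023, §8.8 (PDF p. 209)] -/
theorem exp_heat_mul_le {c τ r a : ℝ} (hc : 0 < c) (hτ : 0 < τ) (hr : 0 < r) (ha0 : 0 ≤ a)
    (ha1 : a ≤ 1) :
    Real.exp (-(c * r ^ 2) * τ) * r ≤ c ^ (-a) * τ ^ (-a) * r ^ (1 - 2 * a) := by
  set x : ℝ := c * r ^ 2 * τ with hxdef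
  have hx : 0 < x := by positivity
  have h1 : Real.exp (-x) ≤ x ^ (-a) := by
    have h := exp_neg_mul_rpow_le_one hx.le ha0 ha1
    have h' := (le_div_iff₀ (Real.rpow_pos_of_pos hx a)).2 h
    rwa [one_div, ← Real.rpow_neg hx.le] at h'
  have h2 : x ^ (-a) = c ^ (-a) * τ ^ (-a) * (r ^ 2) ^ (-a) := by
    rw [hxdef, Real.mul_rpow (by positivity) hτ.le, Real.mul_rpow hc.le (by positivity)]
    ring
  have h3 : (r ^ 2) ^ (-a) * r = r ^ (1 - 2 * a) := by
    rw [← Real.rpow_natCast, ← Real.rpow_mul hr.le]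
    conv_lhs => rw [show (r : ℝ) = r ^ (1 : ℝ) by simp]
    rw [← Real.rpow_mul hr.le, ← Real.rpow_add hr]
    norm_num
    ring_nf
  calc Real.exp (-(c * r ^ 2) * τ) * r = Real.exp (-x) * r := by rw [hxdef]; ring_nf
    _ ≤ x ^ (-a) * r := by gcongr
    _ = c ^ (-a) * τ ^ (-a) * ((r ^ 2) ^ (-a) * r) := by rw [h2]; ring
    _ = c ^ (-a) * τ ^ (-a) * r ^ (1 - 2 * a) := by rw [h3]

/-! ### Power integrals -/

/-- `∫⁻_{(0,h]} s^p ds = h^{p+1}/(p+1)` for `p > -1`, `h ≥ 0`. [folklore] -/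
theorem lintegral_Ioc_rpow {p h : ℝ} (hp : -1 < p) (hh : 0 ≤ h) :
    ∫⁻ s in Ioc 0 h, ENNReal.ofReal (s ^ p) = ENNReal.ofReal (h ^ (p + 1) / (p + 1)) := by
  have hint : IntegrableOn (fun s : ℝ => s ^ p) (Ioc 0 h) volume :=
    (intervalIntegrable_iff_integrableOn_Ioc_of_le hh).1
      (intervalIntegral.intervalIntegrable_rpow' hp)
  have hnn : 0 ≤ᵐ[volume.restrict (Ioc 0 h)] fun s : ℝ => s ^ p :=
    ae_restrict_of_forall_mem measurableSet_Ioc fun s hs => Real.rpow_nonneg hs.1.le _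
  rw [← ofReal_integral_eq_lintegral_ofReal hint hnn, ← intervalIntegral.integral_of_le hh,
    integral_rpow (Or.inl hp), Real.zero_rpow (by linarith), sub_zero]

/-- `∫⁻_{(t-h,t]} (t-s)^p ds = h^{p+1}/(p+1)` for `p > -1`, `h ≥ 0`. [folklore] -/
theorem lintegral_Ioc_sub_rpow {p h t : ℝ} (hp : -1 < p) (hh : 0 ≤ h) :
    ∫⁻ s in Ioc (t - h) t, ENNReal.ofReal ((t - s) ^ p) = ENNReal.ofReal (h ^ (p + 1) / (p + 1)) := by
  have hint0 : IntervalIntegrable (fun s : ℝ => (t - s) ^ p) volume (t - 0) (t - h) :=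
    (intervalIntegral.intervalIntegrable_rpow' hp).comp_sub_left t
  rw [sub_zero] at hint0
  have hint : IntegrableOn (fun s : ℝ => (t - s) ^ p) (Ioc (t - h) t) volume :=
    (intervalIntegrable_iff_integrableOn_Ioc_of_le (by linarith)).1 hint0.symm
  have hnn : 0 ≤ᵐ[volume.restrict (Ioc (t - h) t)] fun s : ℝ => (t - s) ^ p :=
    ae_restrict_of_forall_mem measurableSet_Ioc fun s hs => Real.rpow_nonneg (by linarith [hs.2]) _
  rw [← ofReal_integral_eq_lintegral_ofReal hint hnn,
    ← intervalIntegral.integral_of_le (by linarith : t - h ≤ t),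
    intervalIntegral.integral_comp_sub_left (fun s : ℝ => s ^ p) t, sub_self,
    show t - (t - h) = h by ring, integral_rpow (Or.inl hp), Real.zero_rpow (by linarith), sub_zero]

/-- **The Beta-type bound.** For `0 ≤ a < 1` and `t > 0`,
`∫₀ᵗ (t-s)^{-a} s^{-1/2} ds ≤ (2 + 1/(1-a)) (t/2)^{1/2-a}` (split at `t/2`). [folklore] -/
theorem lintegral_rpow_mul_rpow_le {a t : ℝ} (ha0 : 0 ≤ a) (ha1 : a < 1) (ht : 0 < t) :
    ∫⁻ s in Ioo 0 t, ENNReal.ofReal ((t - s) ^ (-a) * s ^ (-(1 / 2 : ℝ))) ≤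
      ENNReal.ofReal ((2 + 1 / (1 - a)) * (t / 2) ^ (1 / 2 - a)) := by
  have ht2 : 0 < t / 2 := by linarith
  -- the two halves
  have h1 : ∫⁻ s in Ioc 0 (t / 2), ENNReal.ofReal ((t - s) ^ (-a) * s ^ (-(1 / 2 : ℝ))) ≤
      ENNReal.ofReal ((t / 2) ^ (-a) * (2 * (t / 2) ^ (1 / 2 : ℝ))) := by
    calc ∫⁻ s in Ioc 0 (t / 2), ENNReal.ofReal ((t - s) ^ (-a) * s ^ (-(1 / 2 : ℝ)))
        ≤ ∫⁻ s in Ioc 0 (t / 2), ENNReal.ofReal ((t / 2) ^ (-a)) * ENNReal.ofReal (s ^ (-(1 / 2 : ℝ))) := by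
          refine setLIntegral_mono (by fun_prop) fun s hs => ?_
          rw [← ENNReal.ofReal_mul (Real.rpow_nonneg ht2.le _)]
          refine ENNReal.ofReal_le_ofReal ?_
          exact mul_le_mul_of_nonneg_right
            (Real.rpow_le_rpow_of_nonpos ht2 (by linarith [hs.2]) (by linarith))
            (Real.rpow_nonneg hs.1.le _)
      _ = ENNReal.ofReal ((t / 2) ^ (-a)) * ENNReal.ofReal ((t / 2) ^ (-(1 / 2 : ℝ) + 1) / (-(1 / 2 : ℝ) + 1)) := by
          rw [lintegral_const_mul _ (by fun_prop), lintegral_Ioc_rpow (by norm_num) ht2.le]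
      _ = ENNReal.ofReal ((t / 2) ^ (-a) * (2 * (t / 2) ^ (1 / 2 : ℝ))) := by
          rw [← ENNReal.ofReal_mul (Real.rpow_nonneg ht2.le _)]
          have e : (t / 2) ^ (-(1 / 2 : ℝ) + 1) / (-(1 / 2 : ℝ) + 1) = 2 * (t / 2) ^ (1 / 2 : ℝ) := by
            norm_num
            ring
          rw [e]
  have h2 : ∫⁻ s in Ioo (t / 2) t, ENNReal.ofReal ((t - s) ^ (-a) * s ^ (-(1 / 2 : ℝ))) ≤
      ENNReal.ofReal ((t / 2) ^ (-(1 / 2 : ℝ)) * ((t / 2) ^ (1 - a) / (1 - a))) := by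
    calc ∫⁻ s in Ioo (t / 2) t, ENNReal.ofReal ((t - s) ^ (-a) * s ^ (-(1 / 2 : ℝ)))
        ≤ ∫⁻ s in Ioo (t / 2) t, ENNReal.ofReal ((t / 2) ^ (-(1 / 2 : ℝ))) * ENNReal.ofReal ((t - s) ^ (-a)) := by
          refine setLIntegral_mono (by fun_prop) fun s hs => ?_
          rw [← ENNReal.ofReal_mul (Real.rpow_nonneg ht2.le _), mul_comm ((t / 2) ^ _)]
          refine ENNReal.ofReal_le_ofReal ?_
          exact mul_le_mul_of_nonneg_left
            (Real.rpow_le_rpow_of_nonpos ht2 hs.1.le (by norm_num))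
            (Real.rpow_nonneg (by linarith [hs.2]) _)
      _ ≤ ∫⁻ s in Ioc (t - t / 2) t, ENNReal.ofReal ((t / 2) ^ (-(1 / 2 : ℝ))) * ENNReal.ofReal ((t - s) ^ (-a)) := by
          refine lintegral_mono_set ?_
          rw [show t - t / 2 = t / 2 by ring]
          exact Ioo_subset_Ioc_self
      _ = ENNReal.ofReal ((t / 2) ^ (-(1 / 2 : ℝ))) * ENNReal.ofReal ((t / 2) ^ (-a + 1) / (-a + 1)) := by
          rw [lintegral_const_mul _ (by fun_prop), lintegral_Ioc_sub_rpow (by linarith) ht2.le]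
      _ = ENNReal.ofReal ((t / 2) ^ (-(1 / 2 : ℝ)) * ((t / 2) ^ (1 - a) / (1 - a))) := by
          rw [← ENNReal.ofReal_mul (Real.rpow_nonneg ht2.le _)]
          have e : (t / 2) ^ (-a + 1) / (-a + 1) = (t / 2) ^ (1 - a) / (1 - a) := by ring_nf
          rw [e]
  -- combine
  calc ∫⁻ s in Ioo 0 t, ENNReal.ofReal ((t - s) ^ (-a) * s ^ (-(1 / 2 : ℝ)))
      ≤ ∫⁻ s in Ioc 0 (t / 2) ∪ Ioo (t / 2) t, ENNReal.ofReal ((t - s) ^ (-a) * s ^ (-(1 / 2 : ℝ))) := by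
        refine lintegral_mono_set fun s hs => ?_
        rcases le_or_gt s (t / 2) with h | h
        · exact Or.inl ⟨hs.1, h⟩
        · exact Or.inr ⟨h, hs.2⟩
    _ ≤ _ := lintegral_union_le _ _ _
    _ ≤ ENNReal.ofReal ((t / 2) ^ (-a) * (2 * (t / 2) ^ (1 / 2 : ℝ))) +
          ENNReal.ofReal ((t / 2) ^ (-(1 / 2 : ℝ)) * ((t / 2) ^ (1 - a) / (1 - a))) := add_le_add h1 h2
    _ = ENNReal.ofReal ((2 + 1 / (1 - a)) * (t / 2) ^ (1 / 2 - a)) := by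
        rw [← ENNReal.ofReal_add (by positivity) ?_]
        · congr 1
          have e1 : (t / 2) ^ (-a) * (t / 2) ^ (1 / 2 : ℝ) = (t / 2) ^ (1 / 2 - a) := by
            rw [← Real.rpow_add ht2]; ring_nf
          have e2 : (t / 2) ^ (-(1 / 2 : ℝ)) * (t / 2) ^ (1 - a) = (t / 2) ^ (1 / 2 - a) := by
            rw [← Real.rpow_add ht2]; ring_nf
          have h1a : (1 - a) ≠ 0 := by linarith
          calc (t / 2) ^ (-a) * (2 * (t / 2) ^ (1 / 2 : ℝ)) +
                (t / 2) ^ (-(1 / 2 : ℝ)) * ((t / 2) ^ (1 - a) / (1 - a))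
              = 2 * ((t / 2) ^ (-a) * (t / 2) ^ (1 / 2 : ℝ)) +
                ((t / 2) ^ (-(1 / 2 : ℝ)) * (t / 2) ^ (1 - a)) / (1 - a) := by ring
            _ = (2 + 1 / (1 - a)) * (t / 2) ^ (1 / 2 - a) := by rw [e1, e2]; ring
        · have h1a : 0 < 1 - a := by linarith
          positivity

/-- **The heat-weight integral of the Fujita–Kato scheme.** For `c, r, t > 0` and `0 ≤ a < 1`,
`∫₀ᵗ e^{-c r²(t-s)} r s^{-1/2} ds ≤ (2 + 1/(1-a)) c^{-a} r^{1-2a} (t/2)^{1/2-a}`; used with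
`a = 3/4` (the `𝓕Ḣ¹` majorant, weight `t^{1/4}`), `a = 1/2` (the `𝓕Ḣ^{1/2}` bound) and
`a = 1/4` (the `L²` bound) (Lemarié-Rieusset 2023, §8.8, PDF p. 209, the inequation for
`α(t) M₁`, and proof of Thm. 7.4, PDF pp. 151–152). [cite: Lemarierieusset2023, §8.8 (PDF p. 209)] -/
theorem lintegral_heatWeight_le {c r t a : ℝ} (hc : 0 < c) (hr : 0 < r) (ht : 0 < t)
    (ha0 : 0 ≤ a) (ha1 : a < 1) :
    ∫⁻ s in Ioo 0 t, ENNReal.ofReal (Real.exp (-(c * r ^ 2) * (t - s)) * r * s ^ (-(1 / 2 : ℝ))) ≤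
      ENNReal.ofReal (c ^ (-a) * r ^ (1 - 2 * a)) *
        ENNReal.ofReal ((2 + 1 / (1 - a)) * (t / 2) ^ (1 / 2 - a)) := by
  calc ∫⁻ s in Ioo 0 t, ENNReal.ofReal (Real.exp (-(c * r ^ 2) * (t - s)) * r * s ^ (-(1 / 2 : ℝ)))
      ≤ ∫⁻ s in Ioo 0 t, ENNReal.ofReal (c ^ (-a) * r ^ (1 - 2 * a)) *
          ENNReal.ofReal ((t - s) ^ (-a) * s ^ (-(1 / 2 : ℝ))) := by
        refine setLIntegral_mono (by fun_prop) fun s hs => ?_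
        rw [← ENNReal.ofReal_mul (by positivity)]
        refine ENNReal.ofReal_le_ofReal ?_
        have h := exp_heat_mul_le (τ := t - s) hc (by linarith [hs.2]) hr ha0 ha1.le
        calc Real.exp (-(c * r ^ 2) * (t - s)) * r * s ^ (-(1 / 2 : ℝ))
            ≤ c ^ (-a) * (t - s) ^ (-a) * r ^ (1 - 2 * a) * s ^ (-(1 / 2 : ℝ)) := by
              gcongr
              exact Real.rpow_nonneg hs.1.le _
          _ = c ^ (-a) * r ^ (1 - 2 * a) * ((t - s) ^ (-a) * s ^ (-(1 / 2 : ℝ))) := by ring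
    _ = ENNReal.ofReal (c ^ (-a) * r ^ (1 - 2 * a)) *
          ∫⁻ s in Ioo 0 t, ENNReal.ofReal ((t - s) ^ (-a) * s ^ (-(1 / 2 : ℝ))) :=
        lintegral_const_mul _ (by fun_prop)
    _ ≤ _ := by
        gcongr
        exact lintegral_rpow_mul_rpow_le ha0 ha1 ht

end Literature.Analysis.FluidPDE.FujitaKato
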